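import Summits.CriticalPhenomena.CardyFormulaZ2.Theses.CardySelfRefinement
import Summits.CriticalPhenomena.CardyFormulaZ2.Theorems.CardySelfRefinementLagsToInvariance
import Summits.CriticalPhenomena.CardyFormulaZ2.Theorems.CardySelfRefinementLagHandOffQuadCompactness
import Literature.Probability.Percolation.QuadCrossingContinuityEvents
import Literature.Probability.Percolation.QuadCrossingNullFrontier
import HarnessLib

/-!
# The crux `ScaleInvariantLimits` implies lag merging of the lattice laws, modulo Schramm–Smirnov's
# Lemma 5.1 (line `Sketch`, stmt-CriticalPhenomena-10265: why stub A is crux-sized)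

Line `Sketch` reduces the crux `X = ScaleInvariantLimits` (every subsequential scaling limit of the
critical bond-`ℤ²` quad-crossing laws is dilation invariant) to the near-identity gain C⁺ on the
lattice orbit (`stub_latticeNearIdentityGain`), and C⁺ is equivalent on the lattice to LAG MERGING:
for every `k > 1` and every finite family of quads `G`,
`μ_{kη} {S | ∀ i, G i ∈ S} - μ_η {S | ∀ i, G i ∈ S} → 0` as `η → 0⁺`
(`stub_lags_of_nearIdentityGain`, `stub_nearIdentityGain_of_lags`).  Lag merging implies `X`
(`stub_scaleInvariantLimits_of_lags`).  This file proves the remaining arrow of the square,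
**`X` ⇒ lag merging, GIVEN Schramm–Smirnov's Lemma 5.1** (`SchrammSmirnov2011_lemma_5_1`, the
tree's undischarged named fact: crossing events of every quad are continuity sets of every
subsequential limit): if merging failed at lag `k` along meshes `ηₙ → 0⁺`, compactness (SS11
Cor. 1.6, the landed `exists_mem_subseqQuadLimits_tendsto_subseq`) extracts `μ_{ηₙ'} → μ ∈ Λ`;
then `μ_{k ηₙ'} = S_k μ_{ηₙ'} → S_k μ = μ` by `X`, and by Lemma 5.1 + Cor. 5.2
(`tendsto_measure_of_null_frontier_generateFrom`) both joint crossing probabilities converge to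
`μ {S | ∀ i, G i ∈ S}` — contradiction.  So, modulo Lemma 5.1, stub A of the line is EQUIVALENT to
the crux: the near-identity reformulation is exact, and exactly as hard.
-/

noncomputable section

open MeasureTheory Filter Set Topology
open scoped ENNReal
open Literature.Probability.Percolation Literature.Probability.Percolation.QuadCrossing
open Summit.CriticalPhenomena.CardyFormulaZ2.Theses.CardySelfRefinement

namespace Summit.CriticalPhenomena.CardyFormulaZ2.Theorems

/-- **Cor. 5.2 at a subsequential limit, given Lemma 5.1.**  If `μ_{δₙ} → μ` weakly with `μ` a
subsequential scaling limit and Schramm–Smirnov's Lemma 5.1 holds, then the joint crossing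
probability of every finite family of quads converges: `μ_{δₙ} {∀ i, G i ∈ S} → μ {∀ i, G i ∈ S}`
(portmanteau on the finite Boolean algebra of the continuity sets `⊞_{G i}`). -/
theorem tendsto_measureReal_setOf_forall_mem_of_lemma_5_1 (h51 : SchrammSmirnov2011_lemma_5_1)
    {μ : FiniteMeasure (QuadConfig (univ : Set ℂ))} (hμ : μ ∈ subseqQuadLimits (univ : Set ℂ))
    {δs : ℕ → ℝ}
    (hconv : Tendsto (fun n => squareCrossingLaw (univ : Set ℂ) (δs n)) atTop (𝓝 μ))
    {m : ℕ} (G : Fin m → Quad (univ : Set ℂ)) :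
    Tendsto (fun n => (squareCrossingLaw (univ : Set ℂ) (δs n) :
        Measure (QuadConfig (univ : Set ℂ))).real {S | ∀ i, G i ∈ S}) atTop
      (𝓝 ((μ : Measure (QuadConfig (univ : Set ℂ))).real {S | ∀ i, G i ∈ S})) := by
  have h := tendsto_measure_of_null_frontier_generateFrom isOpen_univ univ_nonempty hconv
    (finite_range G) (fun Q _ => h51 univ isOpen_univ univ_nonempty μ hμ Q)
    (measurableSet_generateFrom_setOf_forall_mem G)
  have h' := (ENNReal.tendsto_toReal (measure_ne_top _ _)).comp h
  simp only [measureReal_def]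
  exact h'

/-- **`X` ⇒ lag merging, modulo Lemma 5.1.**  Assume Schramm–Smirnov's Lemma 5.1
(`SchrammSmirnov2011_lemma_5_1`) and the crux `ScaleInvariantLimits`.  Then for every `k > 1`
and every finite family of quads `G` the joint crossing probabilities of critical bond-`ℤ²`
percolation at meshes `k η` and `η` merge as `η → 0⁺`.  (Contrapositive by compactness: a bad
mesh sequence has a subsequence converging in law to some `μ ∈ Λ`; its `k`-dilates converge to
`S_k μ = μ`; Cor. 5.2 makes both joint crossing probabilities converge to the same number.)  With
`stub_lags_of_nearIdentityGain` / `stub_nearIdentityGain_of_lags` / `stub_scaleInvariantLimits_of_lags`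
this closes the square: stub A of line `Sketch` ⇔ lag merging ⇔ `X`, the last arrow modulo
Lemma 5.1. -/
theorem stub_lags_of_scaleInvariantLimits (h51 : SchrammSmirnov2011_lemma_5_1)
    (hX : ScaleInvariantLimits) (k : ℝ) (hk : 1 < k) (m : ℕ) (G : Fin m → Quad (univ : Set ℂ)) :
    Tendsto (fun η : ℝ =>
      (squareCrossingLaw (univ : Set ℂ) (k * η) : Measure (QuadConfig (univ : Set ℂ))).real
          {S | ∀ i, G i ∈ S} -
        (squareCrossingLaw (univ : Set ℂ) η : Measure (QuadConfig (univ : Set ℂ))).real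
          {S | ∀ i, G i ∈ S}) (𝓝[>] 0) (𝓝 0) := by
  have hk0 : 0 < k := by linarith
  set d : ℝ → ℝ := fun η =>
    (squareCrossingLaw (univ : Set ℂ) (k * η) : Measure (QuadConfig (univ : Set ℂ))).real
        {S | ∀ i, G i ∈ S} -
      (squareCrossingLaw (univ : Set ℂ) η : Measure (QuadConfig (univ : Set ℂ))).real
        {S | ∀ i, G i ∈ S} with hd
  rw [Metric.tendsto_nhdsWithin_nhds]
  by_contra hcon
  push Not at hcon
  obtain ⟨ε, hε, hbad⟩ := hcon
  -- a bad positive mesh sequence `ηₙ → 0`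
  choose η hηpos hηdist hηbad using fun n : ℕ => hbad (1 / ((n : ℝ) + 1)) (by positivity)
  have hη0 : Tendsto η atTop (𝓝 0) := by
    rw [tendsto_iff_dist_tendsto_zero]
    exact squeeze_zero (fun n => dist_nonneg) (fun n => (hηdist n).le)
      tendsto_one_div_add_atTop_nhds_zero_nat
  -- compactness: a subsequence converges in law to a subsequential limit `μ`
  have h2 : 0 < Real.sqrt 2 := Real.sqrt_pos.mpr two_pos
  obtain ⟨φ, -, μ, hμ, hconvz⟩ :=
    Cruxes.LagHandOff.CrosscutDictionary.exists_mem_subseqQuadLimits_tendsto_subseq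
      (fun n => η n * Real.sqrt 2) (fun n => mul_pos (hηpos n) h2)
      (by simpa using hη0.mul_const (Real.sqrt 2))
  have hconv : Tendsto (fun n => squareCrossingLaw (univ : Set ℂ) (η (φ n))) atTop (𝓝 μ) := by
    simpa only [squareCrossingLaw_eq_z2QuadLaw] using hconvz
  -- the `k`-dilated laws converge to `S_k μ = μ`
  have hconvk : Tendsto (fun n => squareCrossingLaw (univ : Set ℂ) (k * η (φ n))) atTop (𝓝 μ) := by
    have h := FiniteMeasure.tendsto_map_of_tendsto_of_continuous _ _ hconv
      (QuadConfig.continuous_mapHomeomorph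
        (Homeomorph.mulLeft₀ (k : ℂ) (Complex.ofReal_ne_zero.mpr hk0.ne')))
    have hfun : (fun n => (squareCrossingLaw (univ : Set ℂ) (η (φ n))).map
        (QuadConfig.mapHomeomorph
          (Homeomorph.mulLeft₀ (k : ℂ) (Complex.ofReal_ne_zero.mpr hk0.ne')))) =
        fun n => squareCrossingLaw (univ : Set ℂ) (k * η (φ n)) :=
      funext fun n => dilateLaw_squareCrossingLaw hk0.ne' (η (φ n))
    rw [hfun] at h
    have h' : Tendsto (fun n => squareCrossingLaw (univ : Set ℂ) (k * η (φ n))) atTop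
        (𝓝 (dilateLaw k hk0.ne' μ)) := h
    rwa [hX μ hμ k hk0] at h'
  -- both joint crossing probabilities converge to `μ {∀ i, G i ∈ S}`
  have h1 := tendsto_measureReal_setOf_forall_mem_of_lemma_5_1 h51 hμ hconv G
  have h2' := tendsto_measureReal_setOf_forall_mem_of_lemma_5_1 h51 hμ hconvk G
  have h3 : Tendsto (fun n => d (η (φ n))) atTop (𝓝 0) := by
    have := h2'.sub h1
    rw [sub_self] at this
    simpa only [hd] using this
  -- contradiction with `ε ≤ |d (η (φ n))|`
  obtain ⟨n, hn⟩ := ((Metric.tendsto_nhds.mp h3) ε hε).exists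
  exact (not_le.mpr hn) (hηbad (φ n))

end Summit.CriticalPhenomena.CardyFormulaZ2.Theorems

end
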